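import Summits.BirchSwinnertonDyer.BirchSwinnertonDyer.Theorems.KatoDescentPotSupersingularASideLedgerClassicalOfDvd
import Literature.NumberTheory.GaloisCohomology.PoitouTateSelmerStructures
import Literature.NumberTheory.EllipticCurves.WeilPairingProofs
import Literature.NumberTheory.EllipticCurves.MordellWeilProofs
import HarnessLib

/-!
# THE LEVEL-0 COUNT OF CRUX M MODULO (b″) AND (c2′): `p^{v_p(Tam W)} · #Ш(W)[p^∞] · [A : ℤ_p y₀] ≤ p^{v_p(c_p)} · #Sel_str^{ur}(W[p^∞]) · p^e · (#W(ℚ)_tors)²`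
# — data-free and level-free, from the zeta-line index exponent `e` (brick (b) in counting form) and the Poitou–Tate named fact
# (route `KatoDescentPotSupersingular` / `…Tame…`, crux M = stmt-BirchSwinnertonDyer-19196; route-free helper)

Seat `bsd-potss-rkm` g20 (prover; cell `bsd-potss`), item stmt-BirchSwinnertonDyer-19196 (`--supports … --as helper`; closes nothing).
HONEST FRAMING: BSD is not proved by any of this; nothing is booked; theorems only (no definition, no named fact).  CONDITIONAL on the named fact
`poitouTate_selmerStructure_duality ℚ` (Milne I Thm. 4.10 (b) / Howard Thm. 2.1.11, the tree's finite-level Poitou–Tate families) and on the displayed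
brick (b″).

## What

Part 52 (`exists_forall_aSide_le_classical_of_dvd`) is quantified over the auxiliary levels and the Poitou–Tate / Weil data.  Here the data are
INSTANTIATED (the PT families from the named fact `poitouTate_selmerStructure_duality ℚ`, the Weil pairings from the PROVED `exists_weilPairing_holds`)
and the level `k` is ELIMINATED against brick (b) in its final counting form

  (b″) `∃ k₁, ∀ k ≥ k₁, ∀ j, ∀` (PT family `inv`, Weil datum `ε` at level `p^j p^k`): `p^k ∣ [B_k(ℤ_p y₀) : B_k(ℤ_p y₀) ⊓ 𝓚_k^⊥] · p^e`

(Kato Lemma 14.18 with the value of the dual exponential: the index is `p^{k−e}`, `e = ord_p(L(W,1)/Ω) + v_p(λ(0)) + t_p − v_p(c_p)`; NOT proved here), giving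

* **`tamagawa_mul_sha_mul_index_le_of_zetaLineIndex`** — `W/ℚ` elliptic, `p` odd, `T ∋ v_p` off which `W` is good, `W(ℚ)` finite, `Ш(W)[p^∞]` finite,
  Kato's structures `𝓤∞`/`𝓢∞`, `y₀ ∈ A = H¹(ℤ[1/p],T_pW)` with `p^N A ⊆ ℤ_p y₀`, (b″) with exponent `e`, and `poitouTate_selmerStructure_duality ℚ`:
  **`p^{v_p(Tam W)} · #Ш(W)[p^∞] · [A : ℤ_p y₀] ≤ p^{v_p(c_p)} · #Sel_str^{ur}(W[p^∞]) · p^e · (#W(ℚ)_tors)²`**.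

READING.  In `ord_p` (every factor but the last is a power of `p`): `v_p(Tam) + ord_p #Ш + ord_p [A : ℤ_p y₀] ≤ v_p(c_p) + e + ord_p #Sel_str^{ur} + 2·ord_p #W(ℚ)_tors`
`= a + v_p(λ(0)) + (ord_p #Sel_str^{ur}(W[p^∞]) + t_p) + 2·ord_p #W(ℚ)_tors`; with (c2′) `ord_p #(𝐇²/X𝐇²) = ord_p #Sel_str^{ur} + t_p − t₀` and `t₀ ≤ ord_p #W(ℚ)_tors`
this is the `count` clause of `Kato2004.MemberHullZetaInputs` (item 20297).  So: **`count` ⟸ kernel + (b″) + (c2′) + `poitouTate_selmerStructure_duality ℚ`.**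

References: K. Kato, Astérisque 295 (2004), §14.8, (14.9.3), Prop. 14.16 and its proof (pp. 238–245), Lemma 14.18 (pp. 247–248) [Kato2004Asterisque];
J. S. Milne, *ADT* I Cor. 2.3, Thm. 4.10 (b) [MilneADT2006]; B. Howard, Compos. Math. 140 (2004) Thm. 2.1.11 [Howard2004HeegnerKolyvagin];
J. H. Silverman, *AEC* (2009), III.§8 [SilvermanAEC2009].
-/

-- the summit and its single problem are both named `BirchSwinnertonDyer` (registry layout D-0017)
set_option linter.dupNamespace false
set_option autoImplicit false

noncomputable section

open scoped Classical ContRepresentation NumberField AddSubgroup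
open CategoryTheory Function Field NumberField IsDedekindDomain WeierstrassCurve
open Literature.NumberTheory.EllipticCurves Literature.NumberTheory.GaloisRepresentations
  Literature.NumberTheory.GaloisRepresentations.DiscreteGaloisModule Literature.NumberTheory.GaloisCohomology
open Literature.NumberTheory.EllipticCurves.Kato2004 Literature.NumberTheory.EllipticCurves.Kato2004.EulerSystemValues
open Summit.BirchSwinnertonDyer.Rank1Residual.X11b.Levels Summit.BirchSwinnertonDyer.Rank1Residual.X11b.LocBridge
  Summit.BirchSwinnertonDyer.Rank1Residual.X11b.LevelKummer Summit.BirchSwinnertonDyer.Rank1Residual.X11b.FiniteDuality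
  Summit.BirchSwinnertonDyer.Rank1Residual.X11b.AcSelmer
open Summit.BirchSwinnertonDyer.Rank1Residual.GaloisImage
open Summit.BirchSwinnertonDyer.BirchSwinnertonDyer.Theorems.KummerTowerOrthogonal
open Summit.BirchSwinnertonDyer.BirchSwinnertonDyer.Theorems.ASideJunction

namespace Summit.BirchSwinnertonDyer.BirchSwinnertonDyer.Theorems.KatoFiniteLevelCount

/-! ## §1 Arithmetic -/

section Arith

/-- `p^k ∣ r·p^e` and `N + e ≤ k` give `p^N ∣ r`. [folklore] -/
theorem pow_dvd_of_pow_dvd_mul_pow {p k N e r : ℕ} (hp : 0 < p) (h : p ^ k ∣ r * p ^ e) (hk : N + e ≤ k) : p ^ N ∣ r := by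
  have h1 : p ^ N * p ^ e ∣ r * p ^ e := by rw [← pow_add]; exact (pow_dvd_pow p hk).trans h
  exact Nat.dvd_of_mul_dvd_mul_right (pow_pos hp e) h1

/-- `a ∣ r·b` with `r, b ≠ 0` gives `a ≤ r·b`. [folklore] -/
theorem le_of_dvd_mul_of_ne_zero {a r b : ℕ} (h : a ∣ r * b) (hr : r ≠ 0) (hb : b ≠ 0) : a ≤ r * b :=
  Nat.le_of_dvd (Nat.pos_of_ne_zero (mul_ne_zero hr hb)) h

/-- `#G[m] · #G[n] ∣ (#G_tors)²` for a finite abelian group `G` and `m, n ≠ 0` (both are subgroups of the torsion subgroup). Stated for an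
abstract group so that the group law of `W(ℚ)` enters with ONE instance path (the `DecidableEq ℚ` of the point group).
[cite: SilvermanAEC2009, VII.3 and VIII.6 (the torsion subgroup)] -/
theorem natCard_torsionBy_mul_dvd_natCard_torsion_sq {G : Type*} [AddCommGroup G] [Finite G] (m n : ℤ) (hm : m ≠ 0) (hn : n ≠ 0) :
    Nat.card ↥(G[m]) * Nat.card ↥(G[n]) ∣ Nat.card (AddCommGroup.torsion G) ^ 2 := by
  have h : ∀ k : ℤ, k ≠ 0 → Nat.card ↥(G[k]) ∣ Nat.card (AddCommGroup.torsion G) := fun k hk =>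
    AddSubgroup.card_dvd_of_le fun x hx => by
      rw [AddCommGroup.mem_torsion, isOfFinAddOrder_iff_zsmul_eq_zero]
      exact ⟨k, hk, (Submodule.mem_torsionBy_iff (R := ℤ) k x).mp hx⟩
  rw [sq]; exact mul_dvd_mul (h m hm) (h n hn)

/-- In a finite group every relative index is non-zero. [folklore] -/
theorem relIndex_ne_zero_of_finite {G : Type*} [AddGroup G] [Finite G] (H K : AddSubgroup G) : H.relIndex K ≠ 0 :=
  AddSubgroup.index_ne_zero_of_finite

/-- The assembly: `T·S·r·i ≤ C·(L·pk·tk·tN)`, `pk ≤ r·pe`, `tk·tN ≤ t2`, `0 < pk` give `T·S·i ≤ C·L·pe·t2`. [folklore] -/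
theorem count_arith {T S r i C L pk tk tN pe t2 : ℕ} (h : T * S * r * i ≤ C * (L * pk * tk * tN)) (hr : pk ≤ r * pe)
    (ht : tk * tN ≤ t2) (hpk : 0 < pk) : T * S * i ≤ C * L * pe * t2 := by
  have h1 : T * S * i * pk ≤ C * L * pe * (tk * tN) * pk :=
    calc T * S * i * pk ≤ T * S * i * (r * pe) := Nat.mul_le_mul_left _ hr
      _ = T * S * r * i * pe := by ring
      _ ≤ C * (L * pk * tk * tN) * pe := Nat.mul_le_mul_right _ h
      _ = C * L * pe * (tk * tN) * pk := by ring
  exact (Nat.le_of_mul_le_mul_right h1 hpk).trans (Nat.mul_le_mul_left _ ht)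

end Arith

/-! ## §2 The count -/

section Count

variable (W : WeierstrassCurve ℚ) [W.IsElliptic] (p : ℕ) [Fact p.Prime] [ContinuousSMul ℤ_[p] (W.tateModule p)]
  (𝓤inf 𝓢inf : SelmerStructure (primaryGaloisModule W p))

/-- **THE LEVEL-0 COUNT OF CRUX M MODULO (b″), (c2′) AND THE POITOU–TATE FACT:
`p^{v_p(Tam W)} · #Ш(W)[p^∞] · [A : ℤ_p y₀] ≤ p^{v_p(c_p)} · #Sel_str^{ur}(W[p^∞]) · p^e · (#W(ℚ)_tors)²`** — `W(ℚ)` finite, `Ш(W)[p^∞]` finite,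
`p` odd, `y₀ ∈ A = H¹(ℤ[1/p], T_pW)` with `p^N A ⊆ ℤ_p y₀`, brick (b″) «`p^k ∣ [B_k(ℤ_p y₀) : B_k(ℤ_p y₀) ⊓ 𝓚_k^⊥]·p^e` for `k ≫ 0` and all auxiliary data»
(Kato Lemma 14.18 + value of `exp*`; displayed, not proved), and the named fact `poitouTate_selmerStructure_duality ℚ` (the PT families; the Weil data come
from the PROVED `exists_weilPairing_holds`).  Part 52 at `k = max(k₀,k₁,N+e)+1`, the level `p^k` cancelled against (b″), `#W(ℚ)[p^k]·#W(ℚ)[p^N] ≤ (#W(ℚ)_tors)²`.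
[cite: Kato2004Asterisque, §14.8 (p. 238), (14.9.3) (p. 240), Prop. 14.16 and its proof (pp. 244–245), Lemma 14.18 (pp. 247–248)]
[cite: MilneADT2006, Ch. I, Cor. 2.3, Thm. 4.10 (b)] [cite: Howard2004HeegnerKolyvagin, Thm. 2.1.11] [cite: SilvermanAEC2009, Prop. III.8.1] -/
theorem tamagawa_mul_sha_mul_index_le_of_zetaLineIndex (hPT : poitouTate_selmerStructure_duality ℚ) (hodd : p ≠ 2) (T : Finset (HeightOneSpectrum (𝓞 ℚ)))
    (hpT : primePlace p ∈ T) (hT : ∀ v : HeightOneSpectrum (𝓞 ℚ), v ∉ T → W.HasGoodReductionAt v)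
    [Finite W.toAffine.Point] [Finite (AddCommGroup.primaryComponent (↥W.sha) p)]
    (hUp : 𝓤inf (Sum.inr (primePlace p)) = ⊤)
    (hUur : ∀ v : HeightOneSpectrum (𝓞 ℚ), v ≠ primePlace p →
      𝓤inf (Sum.inr v) = unramifiedSubgroup (GaloisRep.toLocal v (primaryGaloisModule W p)) 1)
    (hUinl : ∀ w : InfinitePlace ℚ, 𝓤inf (Sum.inl w) = ⊤)
    (hSp : 𝓢inf (Sum.inr (primePlace p)) = ⊥)
    (hSur : ∀ v : HeightOneSpectrum (𝓞 ℚ), v ≠ primePlace p →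
      𝓢inf (Sum.inr v) = unramifiedSubgroup (GaloisRep.toLocal v (primaryGaloisModule W p)) 1)
    (hSinl : ∀ w : InfinitePlace ℚ, 𝓢inf (Sum.inl w) = ⊤)
    (y₀ : H1 (tateRep W p) ⊤) (hy₀ : y₀ ∈ integralH1 (tateRep W p) p ⊤) (N : ℕ)
    (hN : ∀ a ∈ integralH1 (tateRep W p) p ⊤, ((p ^ N : ℕ) : ℤ) • a ∈ (ℤ_[p] ∙ y₀).toAddSubgroup) (e : ℕ)
    (hb : ∃ k₁ : ℕ, ∀ k : ℕ, k₁ ≤ k → ∀ j : ℕ,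
      haveI := neZero_pow p j; haveI := neZero_pow p k
      haveI : Finite (geomTorsion W ((p ^ k : ℕ) : ℤ)) := finite_geomTorsion_pow W p k
      ∀ (inv : LocalInvariants ℚ (p ^ j * p ^ k)), inv.SumLocalTermEqZero → inv.IsPerfect →
      ∀ (ε : geomTorsion W ((p ^ j * p ^ k : ℕ) : ℤ) → geomTorsion W ((p ^ j * p ^ k : ℕ) : ℤ) → AlgebraicClosure ℚ)
        (hμ : ∀ S T, ε S T ^ (p ^ j * p ^ k) = 1)
        (hadd₁ : ∀ S₁ S₂ T, ε (S₁ + S₂) T = ε S₁ T * ε S₂ T)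
        (hadd₂ : ∀ S T₁ T₂, ε S (T₁ + T₂) = ε S T₁ * ε S T₂)
        (hgal : ∀ (σ : absoluteGaloisGroup ℚ) (S T : geomTorsion W ((p ^ j * p ^ k : ℕ) : ℤ)), σ • ε S T = ε (σ • S) (σ • T)),
      p ^ k ∣ ((((ℤ_[p] ∙ y₀).toAddSubgroup.map
                  (((galoisCohomology.map (W.torsionInclusion (intPow_dvd_natCast_pow p k)) 1).comp
                      (ofTopSubgroup (W.torsionGaloisModule ((p : ℤ) ^ k)).toTopRep 1).hom.toLinearMap.toAddMonoidHom).comp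
                    (reduceH1Pk W p k ⊤))).map
                  (galoisCohomology.map (DiscreteGaloisModule.pairingDualIntertwining
                    (ρ₁ := W.torsionGaloisModule ((p ^ k : ℕ) : ℤ)) (ρ₂ := W.torsionGaloisModule ((p ^ k : ℕ) : ℤ))
                    (B := descendHom W (p ^ j) (p ^ k) ε hμ hadd₁ hadd₂)
                    (descendHom_smul W (p ^ j) (p ^ k) ε hμ hadd₁ hadd₂ hgal)) 1)).map
                (galoisCohomology.localization ((W.torsionGaloisModule ((p ^ k : ℕ) : ℤ)).tateDual (p ^ j * p ^ k))
                  (Sum.inr (primePlace p)) 1) ⊓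
              annRight (localTatePairingZMod (W.torsionGaloisModule ((p ^ k : ℕ) : ℤ)) (p ^ j * p ^ k)
                (Sum.inr (primePlace p)) (inv (Sum.inr (primePlace p))))
                (W.kummerSelmerStructure ((p ^ k : ℕ) : ℤ) (Sum.inr (primePlace p)))).relIndex
              ((((ℤ_[p] ∙ y₀).toAddSubgroup.map
                  (((galoisCohomology.map (W.torsionInclusion (intPow_dvd_natCast_pow p k)) 1).comp
                      (ofTopSubgroup (W.torsionGaloisModule ((p : ℤ) ^ k)).toTopRep 1).hom.toLinearMap.toAddMonoidHom).comp
                    (reduceH1Pk W p k ⊤))).map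
                  (galoisCohomology.map (DiscreteGaloisModule.pairingDualIntertwining
                    (ρ₁ := W.torsionGaloisModule ((p ^ k : ℕ) : ℤ)) (ρ₂ := W.torsionGaloisModule ((p ^ k : ℕ) : ℤ))
                    (B := descendHom W (p ^ j) (p ^ k) ε hμ hadd₁ hadd₂)
                    (descendHom_smul W (p ^ j) (p ^ k) ε hμ hadd₁ hadd₂ hgal)) 1)).map
                (galoisCohomology.localization ((W.torsionGaloisModule ((p ^ k : ℕ) : ℤ)).tateDual (p ^ j * p ^ k))
                  (Sum.inr (primePlace p)) 1)) * p ^ e) :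
    p ^ padicValNat p W.tamagawaProduct * Nat.card (AddCommGroup.primaryComponent (↥W.sha) p) *
        (ℤ_[p] ∙ y₀).toAddSubgroup.relIndex (integralH1 (tateRep W p) p ⊤).toAddSubgroup ≤
      p ^ padicValNat p ((W.baseChange ((primePlace p).adicCompletion ℚ)).localTamagawaNumber
          ((primePlace p).adicCompletionIntegers ℚ)) * Nat.card 𝓢inf.selmerGroup * p ^ e * W.torsionOrder ^ 2 := by
  have hp : p.Prime := Fact.out
  obtain ⟨k₁, hb⟩ := hb
  obtain ⟨j, s, k₀, hA⟩ :=
    exists_forall_aSide_le_classical_of_dvd W p 𝓤inf 𝓢inf hodd T hpT hT hUp hUur hUinl hSp hSur hSinl y₀ hy₀ N hN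
  -- the level
  obtain ⟨k, hk₀, hk₁, hNe, hk1⟩ : ∃ k : ℕ, k₀ ≤ k ∧ k₁ ≤ k ∧ N + e ≤ k ∧ 1 ≤ k :=
    ⟨max (max k₀ k₁) (N + e) + 1, by omega, by omega, by omega, by omega⟩
  haveI := neZero_pow p j; haveI := neZero_pow p s; haveI := neZero_pow p k
  haveI : Finite (geomTorsion W ((p ^ k : ℕ) : ℤ)) := finite_geomTorsion_pow W p k
  haveI : Finite (geomTorsion W ((p ^ s * p ^ k : ℕ) : ℤ)) :=
    W.finite_torsionPoints_holds (AlgebraicClosure ℚ) (Int.natCast_ne_zero.mpr (NeZero.ne (p ^ s * p ^ k)))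
  have hpk2 : 2 ≤ p ^ k := le_trans hp.two_le (Nat.le_self_pow (by omega) p)
  -- the Poitou–Tate families and the Weil data at the two auxiliary levels
  obtain ⟨inv, hperf, hsum, -, -⟩ := hPT (p ^ j * p ^ k)
  obtain ⟨ε, hμ, hadd₁, hadd₂, -, -, hgal⟩ := (W.exists_weilPairing_holds (p ^ j * p ^ k))
    (le_trans hpk2 (Nat.le_mul_of_pos_left _ (pow_pos hp.pos j))) (Nat.cast_ne_zero.mpr (NeZero.ne (p ^ j * p ^ k)))
  obtain ⟨inv', hperf', -, -, hcompl'⟩ := hPT (p ^ s * p ^ k)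
  obtain ⟨e', hμ', hadd₁', hadd₂', halt', hnondeg', hgal'⟩ := (W.exists_weilPairing_holds (p ^ s * p ^ k))
    (le_trans hpk2 (Nat.le_mul_of_pos_left _ (pow_pos hp.pos s))) (Nat.cast_ne_zero.mpr (NeZero.ne (p ^ s * p ^ k)))
  -- brick (b″) at the level `k`: `p^k ∣ r·p^e`, hence `p^N ∣ r` and `p^k ≤ r·p^e`
  have hbk := hb k hk₁ j inv hsum hperf ε hμ hadd₁ hadd₂ hgal
  have hdvd := pow_dvd_of_pow_dvd_mul_pow hp.pos hbk hNe
  haveI : Finite (galoisCohomology (((W.torsionGaloisModule ((p ^ k : ℕ) : ℤ)).tateDual (p ^ j * p ^ k)).toLocal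
      (Sum.inr (primePlace p))) 1) := finite_galoisCohomology_one_tateDual_toLocal _ _ _
  have hrle := le_of_dvd_mul_of_ne_zero hbk (relIndex_ne_zero_of_finite _ _) (pow_ne_zero e hp.ne_zero)
  -- part 52
  have h := hA k hk₀ inv hsum hperf ε hμ hadd₁ hadd₂ hgal hdvd e' hμ' hadd₁' hadd₂' hgal' halt' hnondeg' inv' hperf' hcompl'
  -- the torsion factor
  -- (`W.torsionOrder` is defined over a general field; `convert` bridges the two `DecidableEq ℚ` paths of the point group law)
  have htO : Nat.card (AddCommGroup.torsion W.toAffine.Point) = W.torsionOrder := by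
    unfold WeierstrassCurve.torsionOrder; convert rfl
  have htors : Nat.card ↥(W.toAffine.Point[((p ^ k : ℕ) : ℤ)]) * Nat.card ↥(W.toAffine.Point[((p ^ N : ℕ) : ℤ)]) ≤
      W.torsionOrder ^ 2 := by
    rw [← htO]
    exact Nat.le_of_dvd (pow_pos Nat.card_pos 2) (natCard_torsionBy_mul_dvd_natCard_torsion_sq _ _
      (Int.natCast_ne_zero.mpr (NeZero.ne (p ^ k))) (Int.natCast_ne_zero.mpr (NeZero.ne (p ^ N))))
  exact count_arith h hrle htors (pow_pos hp.pos k)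

end Count

end Summit.BirchSwinnertonDyer.BirchSwinnertonDyer.Theorems.KatoFiniteLevelCount

end
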